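import Summits.CriticalPhenomena.PercolationContinuityZ3.Theorems.Transplant.FKConnectivityAllQPat3ThetaTsymData3
import Summits.CriticalPhenomena.PercolationContinuityZ3.Theorems.Transplant.FKConnectivityAllQPat3RingTsymData3
import Summits.CriticalPhenomena.PercolationContinuityZ3.Theorems.Transplant.FKConnectivityAllQTsymSP
import HarnessLib

/-!
# Connectivity correlation inequalities for `φ_{w,q}`, every `q > 0` — CONJECTURE T ON THETA AND RING GRAPHS
# (census g36; the antipodal form of THEOREM SP's T_sym part)

Theorems file (`--supports stmt-CriticalPhenomena-4575`), census lane `prim-bschramm-census` (gen 36) of the post-continuity programme (LANE 2 bschramm, FK sub-lane);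
builds on p205010 (kernel theorem, internal audit signed; external expert review pending).
No definitions, no named facts, no sorries; standard axioms.  From the levelwise kernel theorems `FK.thetaTsym_level_nonneg` /
`FK.ringTsym_level_nonneg` (THEOREM SP, product-cone certificates checked by the kernel) to the lane's antipodal quantity:
* (level-sum and relabelling lemmas now in `…Pat3Levels.lean`: `FK.mval2_nonneg_of_lev2`, `FK.tval_tsym_nonneg_of_lev2`, `FK.tval_swap_xy/_ys`, …);
* `FK.theta_tval_tsym_nonneg` / `FK.ring_tval_tsym_nonneg` — `0 ≤ tval w (E_K ∪ E₁ ∪ E₂) b s t tsymTab` for every nonnegative level weight;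
* **`FK.antipodalT_nonneg_theta`** / **`FK.antipodalT_nonneg_ring`** — NEW KERNEL ROWS: for three two-terminal series–parallel
  pieces with inner marks `b, s, t` in the THETA resp. RING configuration and every `q > 0`,
  `0 ≤ antipodalT q z … (E_K ∪ E₁ ∪ E₂) ∅` for each apex `z ∈ {b, s, t}` (`δ ≥ 0` coefficientwise — the three marks on three
  different pieces; `FK.tval_swap_xy/_ys`, `FK.tsymTab_swap/_swap23` move the apex), via
  `FK.antipodalT_eq_tval` and `T(b; s, t) ≥ T_sym` (`FK.tsymTab_le_tApexTab`, file `…TsymSP.lean`).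
[cite: AyyerLinussonRavichandran2025, §7 eq. (13)–(15) (p. 22)] [cite: Grimmett2006, §3.8 (pp. 61–62)]
-/

noncomputable section

namespace Summit.CriticalPhenomena.PercolationContinuityZ3.Theorems

namespace FK

open SimpleGraph Literature.Probability.LatticeModels Literature.Probability.Percolation

/-! ### Conjecture T on THETA and RING graphs (census g36) -/

section SPGraphs

open scoped Classical

variable {V : Type*} [Fintype V]


/-- **NEW KERNEL ROW (census g36): CONJECTURE T ON THETA GRAPHS.**  For three two-terminal series–parallel pieces `E_K ∋ b`,
`E₁ ∋ s`, `E₂ ∋ t` glued in parallel between `u ≠ v` (edge-disjoint, vertex supports pairwise meeting inside `{u, v}`, marks inner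
and off the corners) and every `q > 0`: `0 ≤ antipodalT q b s t (E_K ∪ E₁ ∪ E₂) ∅`, and the same with apex `s` or `t` — `δ(apex; pair) ≥ 0`
coefficientwise with the three marks on THREE DIFFERENT parallel pieces, any of them the apex (`T_sym` is symmetric in the marks).  Proof: `T(b; s, t) ≥ T_sym` coefficientwise (`FK.tsymTab_le_tApexTab`) and
THEOREM SP on THETA graphs (`FK.thetaTsym_level_nonneg`, the kernel-checked product-cone certificate).
[cite: AyyerLinussonRavichandran2025, §7 eq. (13)–(15) (p. 22)] -/
theorem antipodalT_nonneg_theta {q : ℝ} (hq : 0 < q) {EK E₁ E₂ : Finset (Sym2 V)} {VK V₁ V₂ : Set V} {u v b s t : V}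
    (hdK1 : Disjoint EK E₁) (hdK2 : Disjoint EK E₂) (hd12 : Disjoint E₁ E₂)
    (hK : ∀ e ∈ (↑EK : Set (Sym2 V)), ∀ z ∈ e, z ∈ VK)
    (h₁ : ∀ e ∈ (↑E₁ : Set (Sym2 V)), ∀ z ∈ e, z ∈ V₁) (h₂ : ∀ e ∈ (↑E₂ : Set (Sym2 V)), ∀ z ∈ e, z ∈ V₂)
    (hK1 : VK ∩ V₁ ⊆ ({u, v} : Set V)) (hK2 : VK ∩ V₂ ⊆ ({u, v} : Set V)) (h12 : V₁ ∩ V₂ ⊆ ({u, v} : Set V)) (huv : u ≠ v)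
    (hb1 : b ∉ V₁) (hb2 : b ∉ V₂) (hsK : s ∉ VK) (hs2 : s ∉ V₂) (htK : t ∉ VK) (ht1 : t ∉ V₁)
    (hbu : b ≠ u) (hbv : b ≠ v) (hsu : s ≠ u) (hsv : s ≠ v) (htu : t ≠ u) (htv : t ≠ v)
    (hbs : b ≠ s) (hbt : b ≠ t) (hst : s ≠ t)
    (hKsp : IsTTSP EK u v) (h1sp : IsTTSP E₁ u v) (h2sp : IsTTSP E₂ u v)
    (hbK : ∃ e ∈ EK, b ∈ e) (hs1 : ∃ e ∈ E₁, s ∈ e) (ht2 : ∃ e ∈ E₂, t ∈ e) :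
    0 ≤ antipodalT q b s t (↑(EK ∪ E₁ ∪ E₂) : BondConfig V) ∅ ∧ 0 ≤ antipodalT q s b t (↑(EK ∪ E₁ ∪ E₂) : BondConfig V) ∅ ∧
      0 ≤ antipodalT q t s b (↑(EK ∪ E₁ ∪ E₂) : BondConfig V) ∅ := by
  have hw : ∀ n, 0 ≤ (fun n => q ^ n) n := fun n => pow_nonneg hq.le n
  have h0 := tval_tsym_nonneg_of_lev2 (by norm_num) (thetaTsym_level_nonneg hdK1 hdK2 hd12 hK h₁ h₂ hK1 hK2 h12 huv hb1 hb2
    hsK hs2 htK ht1 hbu hbv hsu hsv htu htv hbs hbt hst hKsp h1sp h2sp hbK hs1 ht2) hw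
  have hperm := tval_tsym_nonneg_perm h0
  refine ⟨?_, ?_, ?_⟩ <;> rw [antipodalT_eq_tval]
  · exact h0.trans (tval_mono tsymTab_le_tApexTab hw)
  · exact hperm.1.trans (tval_mono tsymTab_le_tApexTab hw)
  · exact hperm.2.trans (tval_mono tsymTab_le_tApexTab hw)

/-- **NEW KERNEL ROW (census g36): CONJECTURE T ON RING GRAPHS** `K(v,u;b)·Q₁(u,w;s)·Q₂(w,v;t)` of three two-terminal
series–parallel pieces with inner marks: `0 ≤ antipodalT q z … (E_K ∪ E₁ ∪ E₂) ∅` for every apex `z ∈ {b, s, t}` and every `q > 0`.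
[cite: AyyerLinussonRavichandran2025, §7 eq. (13)–(15) (p. 22)] -/
theorem antipodalT_nonneg_ring {q : ℝ} (hq : 0 < q) {EK E₁ E₂ : Finset (Sym2 V)} {VK V₁ V₂ : Set V} {u v w b s t : V}
    (hdK1 : Disjoint EK E₁) (hdK2 : Disjoint EK E₂) (hd12 : Disjoint E₁ E₂)
    (hK : ∀ e ∈ (↑EK : Set (Sym2 V)), ∀ z ∈ e, z ∈ VK)
    (h₁ : ∀ e ∈ (↑E₁ : Set (Sym2 V)), ∀ z ∈ e, z ∈ V₁) (h₂ : ∀ e ∈ (↑E₂ : Set (Sym2 V)), ∀ z ∈ e, z ∈ V₂)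
    (hK1 : VK ∩ V₁ ⊆ ({u} : Set V)) (h12 : V₁ ∩ V₂ ⊆ ({w} : Set V)) (hK2 : VK ∩ V₂ ⊆ ({v} : Set V))
    (hu2 : u ∉ V₂) (hv1 : v ∉ V₁) (huv : u ≠ v) (huw : u ≠ w) (hvw : v ≠ w)
    (hb1 : b ∉ V₁) (hb2 : b ∉ V₂) (hsK : s ∉ VK) (hs2 : s ∉ V₂) (htK : t ∉ VK) (ht1 : t ∉ V₁)
    (hbu : b ≠ u) (hbv : b ≠ v) (hsu : s ≠ u) (hsv : s ≠ v) (hsw : s ≠ w) (htu : t ≠ u) (htv : t ≠ v) (htw : t ≠ w)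
    (hbs : b ≠ s) (hbt : b ≠ t) (hst : s ≠ t)
    (hKsp : IsTTSP EK v u) (h1sp : IsTTSP E₁ u w) (h2sp : IsTTSP E₂ w v)
    (hbK : ∃ e ∈ EK, b ∈ e) (hs1 : ∃ e ∈ E₁, s ∈ e) (ht2 : ∃ e ∈ E₂, t ∈ e) :
    0 ≤ antipodalT q b s t (↑(EK ∪ E₁ ∪ E₂) : BondConfig V) ∅ ∧ 0 ≤ antipodalT q s b t (↑(EK ∪ E₁ ∪ E₂) : BondConfig V) ∅ ∧
      0 ≤ antipodalT q t s b (↑(EK ∪ E₁ ∪ E₂) : BondConfig V) ∅ := by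
  have hw : ∀ n, 0 ≤ (fun n => q ^ n) n := fun n => pow_nonneg hq.le n
  have h0 := tval_tsym_nonneg_of_lev2 (by norm_num) (ringTsym_level_nonneg hdK1 hdK2 hd12 hK h₁ h₂ hK1 h12 hK2 hu2 hv1 huv huw
    hvw hb1 hb2 hsK hs2 htK ht1 hbu hbv hsu hsv hsw htu htv htw hbs hbt hst hKsp h1sp h2sp hbK hs1 ht2) hw
  have hperm := tval_tsym_nonneg_perm h0
  refine ⟨?_, ?_, ?_⟩ <;> rw [antipodalT_eq_tval]
  · exact h0.trans (tval_mono tsymTab_le_tApexTab hw)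
  · exact hperm.1.trans (tval_mono tsymTab_le_tApexTab hw)
  · exact hperm.2.trans (tval_mono tsymTab_le_tApexTab hw)

/-- **THEOREM SP (THETA, T_sym) for every nonnegative level weight**: `0 ≤ tval w (E_K ∪ E₁ ∪ E₂) b s t tsymTab`. [folklore] -/
theorem theta_tval_tsym_nonneg {EK E₁ E₂ : Finset (Sym2 V)} {VK V₁ V₂ : Set V} {u v b s t : V}
    (hdK1 : Disjoint EK E₁) (hdK2 : Disjoint EK E₂) (hd12 : Disjoint E₁ E₂)
    (hK : ∀ e ∈ (↑EK : Set (Sym2 V)), ∀ z ∈ e, z ∈ VK)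
    (h₁ : ∀ e ∈ (↑E₁ : Set (Sym2 V)), ∀ z ∈ e, z ∈ V₁) (h₂ : ∀ e ∈ (↑E₂ : Set (Sym2 V)), ∀ z ∈ e, z ∈ V₂)
    (hK1 : VK ∩ V₁ ⊆ ({u, v} : Set V)) (hK2 : VK ∩ V₂ ⊆ ({u, v} : Set V)) (h12 : V₁ ∩ V₂ ⊆ ({u, v} : Set V)) (huv : u ≠ v)
    (hb1 : b ∉ V₁) (hb2 : b ∉ V₂) (hsK : s ∉ VK) (hs2 : s ∉ V₂) (htK : t ∉ VK) (ht1 : t ∉ V₁)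
    (hbu : b ≠ u) (hbv : b ≠ v) (hsu : s ≠ u) (hsv : s ≠ v) (htu : t ≠ u) (htv : t ≠ v)
    (hbs : b ≠ s) (hbt : b ≠ t) (hst : s ≠ t)
    (hKsp : IsTTSP EK u v) (h1sp : IsTTSP E₁ u v) (h2sp : IsTTSP E₂ u v)
    (hbK : ∃ e ∈ EK, b ∈ e) (hs1 : ∃ e ∈ E₁, s ∈ e) (ht2 : ∃ e ∈ E₂, t ∈ e) {w : ℕ → ℝ} (hw : ∀ n, 0 ≤ w n) :
    0 ≤ tval w (EK ∪ E₁ ∪ E₂) b s t tsymTab :=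
  tval_tsym_nonneg_of_lev2 (by norm_num) (thetaTsym_level_nonneg hdK1 hdK2 hd12 hK h₁ h₂ hK1 hK2 h12 huv hb1 hb2 hsK hs2 htK
    ht1 hbu hbv hsu hsv htu htv hbs hbt hst hKsp h1sp h2sp hbK hs1 ht2) hw

/-- **THEOREM SP (RING, T_sym) for every nonnegative level weight**: `0 ≤ tval w (E_K ∪ E₁ ∪ E₂) b s t tsymTab`. [folklore] -/
theorem ring_tval_tsym_nonneg {EK E₁ E₂ : Finset (Sym2 V)} {VK V₁ V₂ : Set V} {u v w b s t : V}
    (hdK1 : Disjoint EK E₁) (hdK2 : Disjoint EK E₂) (hd12 : Disjoint E₁ E₂)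
    (hK : ∀ e ∈ (↑EK : Set (Sym2 V)), ∀ z ∈ e, z ∈ VK)
    (h₁ : ∀ e ∈ (↑E₁ : Set (Sym2 V)), ∀ z ∈ e, z ∈ V₁) (h₂ : ∀ e ∈ (↑E₂ : Set (Sym2 V)), ∀ z ∈ e, z ∈ V₂)
    (hK1 : VK ∩ V₁ ⊆ ({u} : Set V)) (h12 : V₁ ∩ V₂ ⊆ ({w} : Set V)) (hK2 : VK ∩ V₂ ⊆ ({v} : Set V))
    (hu2 : u ∉ V₂) (hv1 : v ∉ V₁) (huv : u ≠ v) (huw : u ≠ w) (hvw : v ≠ w)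
    (hb1 : b ∉ V₁) (hb2 : b ∉ V₂) (hsK : s ∉ VK) (hs2 : s ∉ V₂) (htK : t ∉ VK) (ht1 : t ∉ V₁)
    (hbu : b ≠ u) (hbv : b ≠ v) (hsu : s ≠ u) (hsv : s ≠ v) (hsw : s ≠ w) (htu : t ≠ u) (htv : t ≠ v) (htw : t ≠ w)
    (hbs : b ≠ s) (hbt : b ≠ t) (hst : s ≠ t)
    (hKsp : IsTTSP EK v u) (h1sp : IsTTSP E₁ u w) (h2sp : IsTTSP E₂ w v)
    (hbK : ∃ e ∈ EK, b ∈ e) (hs1 : ∃ e ∈ E₁, s ∈ e) (ht2 : ∃ e ∈ E₂, t ∈ e) {wt : ℕ → ℝ} (hw : ∀ n, 0 ≤ wt n) :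
    0 ≤ tval wt (EK ∪ E₁ ∪ E₂) b s t tsymTab :=
  tval_tsym_nonneg_of_lev2 (by norm_num) (ringTsym_level_nonneg hdK1 hdK2 hd12 hK h₁ h₂ hK1 h12 hK2 hu2 hv1 huv huw hvw hb1 hb2
    hsK hs2 htK ht1 hbu hbv hsu hsv hsw htu htv htw hbs hbt hst hKsp h1sp h2sp hbK hs1 ht2) hw

end SPGraphs


end FK

end Summit.CriticalPhenomena.PercolationContinuityZ3.Theorems

end
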